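import Mathlib.MeasureTheory.Integral.Lebesgue.Basic
import Mathlib.MeasureTheory.Integral.Lebesgue.Add
import Mathlib.Topology.Compactness.Compact
import Mathlib.Data.NNReal.Basic
import Literature.MeasureTheory.Group.PadicIntHaarScaling
import HarnessLib

/-!
# [IUTchIII] Remark 3.9.4: realified semi-simplifications of measure spaces and the log-link
# compatibility of log-volumes (abc-iut cell, layer L6, slice [IUTchIII] §3)

S. Mochizuki, *Inter-universal Teichmüller theory III*, kurims manuscript (May 2020) of PRIMS
**57** (2021), §3, Remark 3.9.4 (i)–(vi), kurims pp. 120–126 (PRIMS offset ≈ +420). Remark 3.9.4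
reformulates the log-link compatibility of Proposition 3.9 (iv) through an elementary
measure-theoretic device. STATEMENTS-FIRST typing; (i) and (ii) are REAL:

* (i) pre-ample / ample subsets, ample measure spaces, `Sub(M)`, the monoid `Fn(M)` of finitely-valued
  Borel functions `f : M → ℝ_{≥0}` with pre-ample support, its `ℝ_{>0}`-action, integration
  `∫_M : Fn(M) → ℝ_{≥0}`, the characteristic-function embedding `Sub(M) ↪ Fn(M)` with
  `∫_M χ_S = μ_M(S)` (PROVED), the **realified semi-simplification** `Rss(M) := Fn(M)/∫_M` with the
  injection `∫^{Rss}_M : Rss(M) → ℝ_{≥0}` (PROVED injective; surjectivity for ample `M` is the named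
  statement `Rss_integral_surjective`), and the two printed properties of the quotient (sets of equal
  measure are identified; disjoint unions go to sums — PROVED).
* (ii) the `ℚ_p` example: multiplication by `p` dilates Haar volumes by the factor `p^{-1} (≠ 1)` — PROVED
  on `ℤ_p` from the tree's `Literature.MeasureTheory.Group.PadicIntHaarScaling`; the moral ("log-volumes
  would only be well-defined in `ℝ/ℤ·log(λ)`") recorded in the docstring.
* (iii)–(vi) (the commutative diagrams of `Rss(−)` induced by `log_k` on `𝒪^×_k`, compatibility with
  finite extensions and tensor products `k_{i_A}`, the bad-prime version with `ℕ ↪ Rss(k) → ℝ ∪ {−∞}`,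
  `1 ↦ −log(q)`, and the archimedean version via `exp_k`) rest on [AbsTopIII] Prop. 5.7 (i)(c), (ii)(c)
  (abc-iut-L4-t3) and are typed as named `Prop`s over abstract data.
Tag form [claim: Mochizuki2012, status: disputed] (D-0012 claim key).
-/

namespace Literature.IUT.LogThetaLattice

open _root_.MeasureTheory _root_.Set
open scoped NNReal ENNReal

universe u

namespace Rss

variable {M : Type u} [TopologicalSpace M] [MeasurableSpace M] (μ : Measure M)

/-- **IUTchIII:Rmk3.9.4(i)** (kurims p.120 l.23) "We shall say that a subset `S ⊆ M` is pre-ample if `S`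
is a relatively compact Borel set". [claim: Mochizuki2012, status: disputed] -/
structure IsPreAmple (S : Set M) : Prop where
  /-- relatively compact -/
  relCompact : IsCompact (closure S)
  /-- Borel -/
  measurableSet : MeasurableSet S

/-- **IUTchIII:Rmk3.9.4(i)** (kurims p.120 l.24) "a pre-ample subset `S ⊆ M` is ample if `μ_M(S) > 0`".
[claim: Mochizuki2012, status: disputed] -/
structure IsAmple (S : Set M) : Prop where
  /-- pre-ample -/
  preAmple : IsPreAmple S
  /-- positive measure -/
  pos : 0 < μ S

/-- **IUTchIII:Rmk3.9.4(i)** (kurims p.120 l.25) "`(M, μ_M)` is ample if there exists an ample subset of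
`M`". [claim: Mochizuki2012, status: disputed] -/
@[mk_iff] structure IsAmpleSpace : Prop where
  /-- there is an ample subset -/
  exists_ample : ∃ S : Set M, IsAmple μ S

/-- **IUTchIII:Rmk3.9.4(i)** (kurims p.120 l.29) "`Sub(M)` for the set of pre-ample subsets of `M`".
[claim: Mochizuki2012, status: disputed] -/
def Sub : Set (Set M) := {S | IsPreAmple S}

/-- **IUTchIII:Rmk3.9.4(i)** (kurims p.120 l.31) "`Fn(M)` for the set of Borel measurable functions
`f : M → ℝ_{≥0}` such that the image `f(M) ⊆ ℝ_{≥0}` of `f` is a finite set, and, moreover,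
`M ⊇ f^{-1}(ℝ_{>0}) ∈ Sub(M)`". [claim: Mochizuki2012, status: disputed] -/
structure Fn where
  /-- the function -/
  toFun : M → ℝ≥0
  /-- Borel measurable -/
  measurable : Measurable toFun
  /-- finitely many values -/
  finite_range : (Set.range toFun).Finite
  /-- the support is pre-ample -/
  support_preAmple : IsPreAmple (toFun ⁻¹' Set.Ioi 0)

omit [MeasurableSpace M] in
/-- A finite union of pre-ample sets is pre-ample. [folklore] -/
private lemma isPreAmple_union [MeasurableSpace M] {S T : Set M} (hS : IsPreAmple S)
    (hT : IsPreAmple T) : IsPreAmple (S ∪ T) :=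
  ⟨by rw [closure_union]; exact hS.relCompact.union hT.relCompact,
    hS.measurableSet.union hT.measurableSet⟩

/-- **IUTchIII:Rmk3.9.4(i)** (kurims p.120 l.33) "`Fn(M)` is equipped with a natural monoid structure
[induced by the natural monoid structure on `ℝ_{≥0}`]" — pointwise addition (CONSTRUCTED: the sum of two
finitely-valued Borel functions with pre-ample support is again such).
[claim: Mochizuki2012, status: disputed] -/
def Fn.add (f g : Fn (M := M)) : Fn (M := M) where
  toFun := f.toFun + g.toFun
  measurable := f.measurable.add g.measurable
  finite_range := by
    refine ((f.finite_range.prod g.finite_range).image fun q => q.1 + q.2).subset ?_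
    rintro _ ⟨x, rfl⟩
    exact ⟨(f.toFun x, g.toFun x), ⟨⟨x, rfl⟩, ⟨x, rfl⟩⟩, rfl⟩
  support_preAmple := by
    have h : (f.toFun + g.toFun) ⁻¹' Set.Ioi 0 = f.toFun ⁻¹' Set.Ioi 0 ∪ g.toFun ⁻¹' Set.Ioi 0 := by
      ext x
      simp only [Set.mem_preimage, Pi.add_apply, Set.mem_Ioi, Set.mem_union, add_pos_iff]
    rw [h]
    exact isPreAmple_union f.support_preAmple g.support_preAmple

/-- **IUTchIII:Rmk3.9.4(i)** (kurims p.120 l.34) "… as well as a natural action by `ℝ_{>0}` [induced by …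
multiplication of `ℝ_{>0}` on `ℝ_{≥0}`]" (CONSTRUCTED). [claim: Mochizuki2012, status: disputed] -/
def Fn.smul (r : ℝ≥0) (hr : 0 < r) (f : Fn (M := M)) : Fn (M := M) where
  toFun := fun x => r * f.toFun x
  measurable := f.measurable.const_mul r
  finite_range := by
    refine (f.finite_range.image fun t => r * t).subset ?_
    rintro _ ⟨x, rfl⟩
    exact ⟨f.toFun x, ⟨x, rfl⟩, rfl⟩
  support_preAmple := by
    have h : (fun x => r * f.toFun x) ⁻¹' Set.Ioi 0 = f.toFun ⁻¹' Set.Ioi 0 := by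
      ext x
      simp only [Set.mem_preimage, Set.mem_Ioi]
      exact ⟨fun hx => pos_of_mul_pos_right hx hr.le, fun hx => mul_pos hr hx⟩
    rw [h]
    exact f.support_preAmple

/-- **IUTchIII:Rmk3.9.4(i)** (kurims p.120 l.35) "By assigning to an element `S ∈ Sub(M)` the characteristic
function `χ_S : M → ℝ_{≥0}` …, we shall regard `Sub(M)` as a subset of `Fn(M)`" (CONSTRUCTED).
[claim: Mochizuki2012, status: disputed] -/
noncomputable def Fn.ofSub (S : Set M) (hS : IsPreAmple S) : Fn (M := M) where
  toFun := S.indicator fun _ => 1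
  measurable := measurable_const.indicator hS.measurableSet
  finite_range := ((Set.finite_singleton (1 : ℝ≥0)).insert 0).subset (by
    rintro _ ⟨x, rfl⟩
    by_cases hx : x ∈ S <;> simp [Set.indicator, hx])
  support_preAmple := by
    have h : (S.indicator fun _ => (1 : ℝ≥0)) ⁻¹' Set.Ioi 0 = S := by
      ext x
      by_cases hx : x ∈ S <;> simp [Set.indicator, hx]
    rw [h]
    exact hS

/-- **IUTchIII:Rmk3.9.4(i)** (kurims p.120 l.37) "integration over `M`, relative to the measure `μ_M`,
determines an `ℝ_{>0}`-equivariant surjection `∫_M : Fn(M) ↠ ℝ_{≥0}`" — the integral (valued in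
`ℝ_{≥0} ∪ {∞}`; finite for measures finite on compacta). [claim: Mochizuki2012, status: disputed] -/
noncomputable def Fn.integral (f : Fn (M := M)) : ℝ≥0∞ := ∫⁻ x, (f.toFun x : ℝ≥0∞) ∂μ

/-- **IUTchIII:Rmk3.9.4(i)** (kurims p.120 l.38) "… whose restriction to `Sub(M)` maps `Sub(M) ∋ S ↦
μ_M(S) ∈ ℝ_{≥0}`" — PROVED. [claim: Mochizuki2012, status: disputed] -/
theorem Fn.integral_ofSub (S : Set M) (hS : IsPreAmple S) : (Fn.ofSub S hS).integral μ = μ S := by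
  simp only [Fn.integral, Fn.ofSub]
  have h : (fun x => ((S.indicator (fun _ => (1 : ℝ≥0)) x : ℝ≥0) : ℝ≥0∞))
      = S.indicator fun _ => (1 : ℝ≥0∞) := by
    funext x
    by_cases hx : x ∈ S <;> simp [Set.indicator, hx]
  rw [h, lintegral_indicator hS.measurableSet]
  simp

/-- `ℝ_{>0}`-equivariance of `∫_M` (Rmk 3.9.4 (i), p.120 l.37) — PROVED.
[claim: Mochizuki2012, status: disputed] -/
theorem Fn.integral_smul (r : ℝ≥0) (hr : 0 < r) (f : Fn (M := M)) :
    (Fn.smul r hr f).integral μ = r * f.integral μ := by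
  simp only [Fn.integral, Fn.smul, ENNReal.coe_mul]
  rw [lintegral_const_mul _ (by exact measurable_coe_nnreal_ennreal.comp f.measurable)]

/-- Additivity of `∫_M` (the monoid-homomorphism property implicit in Rmk 3.9.4 (i), p.121 l.1: the
quotient `Rss(M)` "admits a natural monoid structure") — PROVED. [claim: Mochizuki2012, status: disputed] -/
theorem Fn.integral_add (f g : Fn (M := M)) :
    (Fn.add f g).integral μ = f.integral μ + g.integral μ := by
  simp only [Fn.integral, Fn.add, Pi.add_apply, ENNReal.coe_add]
  exact lintegral_add_left (measurable_coe_nnreal_ennreal.comp f.measurable) _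

/-- **IUTchIII:Rmk3.9.4(i)** (kurims p.120 l.40 – p.121 l.2) The **realified semi-simplification**
`Fn^{Rss}_M : Fn(M) ↠ Rss(M)`: "the quotient set of `Fn(M)` … determined by `∫_M`" (two functions are
identified iff they have the same integral). [claim: Mochizuki2012, status: disputed] -/
def Carrier : Type u := Quot fun f g : Fn (M := M) => f.integral μ = g.integral μ

/-- The quotient map `Fn^{Rss}_M : Fn(M) ↠ Rss(M)` (Rmk 3.9.4 (i), p.120 l.40).
[claim: Mochizuki2012, status: disputed] -/
def mk (f : Fn (M := M)) : Carrier μ := Quot.mk _ f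

/-- **IUTchIII:Rmk3.9.4(i)** (kurims p.121 l.2) "`∫^{Rss}_M : Rss(M) → ℝ_{≥0}` such that
`∫_M = ∫^{Rss}_M ∘ Fn^{Rss}_M`" — CONSTRUCTED (descends to the quotient by definition).
[claim: Mochizuki2012, status: disputed] -/
noncomputable def integral : Carrier μ → ℝ≥0∞ :=
  Quot.lift (fun f => f.integral μ) fun _ _ h => h

/-- `∫_M = ∫^{Rss}_M ∘ Fn^{Rss}_M` (Rmk 3.9.4 (i), p.121 l.3) — PROVED (by `rfl`).
[claim: Mochizuki2012, status: disputed] -/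
theorem integral_mk (f : Fn (M := M)) : integral μ (mk μ f) = f.integral μ := rfl

/-- `∫^{Rss}_M` is injective (Rmk 3.9.4 (i), p.121 l.2: "natural … isomorphism of monoids
`∫^{Rss}_M : Rss(M) ≅ ℝ_{≥0}`" — the injectivity half) — PROVED. [claim: Mochizuki2012, status: disputed] -/
theorem integral_injective : Function.Injective (integral μ) := by
  rintro ⟨f⟩ ⟨g⟩ h
  exact Quot.sound h

/-- **IUTchIII:Rmk3.9.4(i)** (kurims p.121 l.2) surjectivity half of "`∫^{Rss}_M : Rss(M) ≅ ℝ_{≥0}`" for an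
AMPLE measure space whose ample set has finite measure: every `t ∈ ℝ_{≥0}` is the integral of
`(t/μ(S)) · χ_S`. Named statement (TODO(discharge): ≈ 20 lines with `Fn.integral_smul`,
`Fn.integral_ofSub`; the case `t = 0` uses `χ_∅`). [claim: Mochizuki2012, status: disputed] -/
def Rss_integral_surjective : Prop :=
  IsAmpleSpace μ → (∀ S, IsAmple μ S → μ S ≠ ∞) →
    ∀ t : ℝ≥0, ∃ x : Carrier μ, integral μ x = t

/-- Surjectivity of `∫^{Rss}_M` for an ample measure space (Rmk 3.9.4 (i), p.121 l.2) — PROVED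
(`(t/μ(S)) · χ_S` has integral `t`; `χ_∅` has integral `0`). [claim: Mochizuki2012, status: disputed] -/
theorem Rss_integral_surjective_holds : Rss_integral_surjective μ := by
  rintro ⟨S0, hS0⟩ hfin t
  by_cases ht : t = 0
  · refine ⟨mk μ (Fn.ofSub ∅ ⟨by simp, MeasurableSet.empty⟩), ?_⟩
    rw [integral_mk, Fn.integral_ofSub, measure_empty, ht, ENNReal.coe_zero]
  · have hm : μ S0 ≠ ∞ := hfin S0 hS0
    have hmpos : 0 < (μ S0).toNNReal := ENNReal.toNNReal_pos hS0.pos.ne' hm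
    have hcpos : 0 < t / (μ S0).toNNReal := div_pos (pos_iff_ne_zero.mpr ht) hmpos
    refine ⟨mk μ (Fn.smul (t / (μ S0).toNNReal) hcpos (Fn.ofSub S0 hS0.preAmple)), ?_⟩
    rw [integral_mk, Fn.integral_smul, Fn.integral_ofSub]
    calc ((t / (μ S0).toNNReal : ℝ≥0) : ℝ≥0∞) * μ S0
        = ((t / (μ S0).toNNReal : ℝ≥0) : ℝ≥0∞) * ((μ S0).toNNReal : ℝ≥0∞) := by
          rw [ENNReal.coe_toNNReal hm]
      _ = ((t / (μ S0).toNNReal * (μ S0).toNNReal : ℝ≥0) : ℝ≥0∞) := by rw [ENNReal.coe_mul]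
      _ = (t : ℝ≥0∞) := by rw [div_mul_cancel₀ _ hmpos.ne']

/-- **IUTchIII:Rmk3.9.4(i)** (kurims p.121 l.8–14) the two printed properties of the quotient restricted to
`Sub(M)`: it "identifies `S₁, S₂ ∈ Sub(M)` such that `μ_M(S₁) = μ_M(S₂)`" and "maps `S₁ ∪ S₂ ∈ Sub(M)` to the
sum … of the images of `S₁, S₂ ∈ Sub(M)` whenever `S₁, S₂ … are disjoint" — PROVED (first: by
definition of the quotient; second: additivity of the measure / of `∫_M`).
[claim: Mochizuki2012, status: disputed] -/
theorem mk_ofSub_eq_of_measure_eq {S₁ S₂ : Set M} (h₁ : IsPreAmple S₁) (h₂ : IsPreAmple S₂)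
    (h : μ S₁ = μ S₂) : mk μ (Fn.ofSub S₁ h₁) = mk μ (Fn.ofSub S₂ h₂) := by
  apply Quot.sound
  rw [Fn.integral_ofSub, Fn.integral_ofSub, h]

/-- Second printed property (p.121 l.11): for disjoint pre-ample `S₁, S₂`, `χ_{S₁ ∪ S₂}` and `χ_{S₁} + χ_{S₂}`
have the same image in `Rss(M)`, whose integral is `μ(S₁) + μ(S₂)` — PROVED.
[claim: Mochizuki2012, status: disputed] -/
theorem integral_mk_union {S₁ S₂ : Set M} (h₁ : IsPreAmple S₁) (h₂ : IsPreAmple S₂)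
    (hdisj : Disjoint S₁ S₂) :
    integral μ (mk μ (Fn.ofSub (S₁ ∪ S₂) (isPreAmple_union h₁ h₂)))
      = integral μ (mk μ (Fn.add (Fn.ofSub S₁ h₁) (Fn.ofSub S₂ h₂))) := by
  rw [integral_mk, integral_mk, Fn.integral_add, Fn.integral_ofSub, Fn.integral_ofSub,
    Fn.integral_ofSub, measure_union hdisj h₂.measurableSet]

/-- **IUTchIII:Rmk3.9.4(i)** (kurims p.121 l.15) "a subset `E ⊆ Fn(M)` [is] ample if
`ℝ_{>0} ∩ ∫_M(E) ≠ ∅`". [claim: Mochizuki2012, status: disputed] -/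
def IsAmpleFamily (E : Set (Fn (M := M))) : Prop := ∃ f ∈ E, 0 < f.integral μ ∧ f.integral μ ≠ ∞

/-- **IUTchIII:Rmk3.9.4(i)** (kurims p.121 l.30–40) products: "if `(M₁, μ_{M₁})` and `(M₂, μ_{M₂})` are ample
measure spaces, then the product measure space … is also an ample measure space; moreover, there is a
natural map `Sub(M₁) × Sub(M₂) → Sub(M₁ × M₂)` that maps `(S₁, S₂) ↦ S₁ × S₂` and induces a natural
`ℝ_{>0}`-equivariant isomorphism of monoids `Rss(M₁) ⊗ Rss(M₂) ≅ Rss(M₁ × M₂)`". Typed: the product of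
pre-ample sets is pre-ample — PROVED; the tensor-product isomorphism (both sides `≅ ℝ_{≥0}`) is the
multiplicativity `μ(S₁ × S₂) = μ(S₁) μ(S₂)` of the product measure (Mathlib `Measure.prod_prod`).
[claim: Mochizuki2012, status: disputed] -/
theorem isPreAmple_prod {M₁ M₂ : Type u} [TopologicalSpace M₁] [MeasurableSpace M₁]
    [TopologicalSpace M₂] [MeasurableSpace M₂] {S₁ : Set M₁} {S₂ : Set M₂}
    (h₁ : IsPreAmple S₁) (h₂ : IsPreAmple S₂) : IsPreAmple (S₁ ×ˢ S₂) :=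
  ⟨by rw [closure_prod_eq]; exact h₁.relCompact.prod h₂.relCompact,
    h₁.measurableSet.prod h₂.measurableSet⟩

end Rss

/-! ### Remark 3.9.4 (ii): the `ℚ_p` dilation example -/

section Dilation

variable (p : ℕ) [Fact p.Prime]

/-- **IUTchIII:Rmk3.9.4(ii)** (kurims p.122 l.10–20) "Suppose that `M := ℚ_p` …, equipped with the
[additive] Haar measure `μ_{ℚ_p}` normalized so that `ℤ_p ⊆ ℚ_p` has measure `1` … Then multiplication by `p`
induces a bijection `α_p : ℚ_p ≅ ℚ_p` … `Rss(α_p)` is not compatible with the isomorphisms `∫^{Rss}_{ℚ_p}` …,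
i.e., it is only compatible up to a factor `p^{-1} (≠ 1)`!" — PROVED for subsets of `ℤ_p` (where the
tree's normalised Haar measure lives): `μ(p · S) = p^{-1} · μ(S)`. The printed moral: if each log-link
dilated volumes by `λ ≠ 1`, log-volumes would only be well-defined in `ℝ/ℤ·log(λ) (≅ S¹)`, "a situation
which is not acceptable" for Corollary 3.12. [claim: Mochizuki2012, status: disputed] -/
theorem Remark394ii_dilation (S : Set ℤ_[p]) :
    MeasureTheory.volume ((fun x => (p : ℤ_[p]) * x) '' S)
      = ((p : ℝ≥0∞))⁻¹ * MeasureTheory.volume S := by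
  have h := Literature.MeasureTheory.Group.padicInt_volume_image_pow_mul (p := p) 1 S
  simpa using h

/-- The factor is `≠ 1` (Rmk 3.9.4 (ii), p.122 l.20: "`p^{-1} (≠ 1)`") — PROVED.
[claim: Mochizuki2012, status: disputed] -/
theorem Remark394ii_factor_ne_one : ((p : ℝ≥0∞))⁻¹ ≠ 1 := by
  have hp : (1 : ℕ) < p := (Fact.out : p.Prime).one_lt
  intro h
  rw [ENNReal.inv_eq_one] at h
  exact absurd h (by exact_mod_cast hp.ne')

end Dilation

/-! ### Remark 3.9.4 (iii)–(vi): log-link compatibility diagrams (named statements) -/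

section LogCompat

/-- **IUTchIII:Rmk3.9.4(iii)** (kurims p.122 l.32 – p.123 l.30) For `k` a finite extension of `ℚ_p` with
`μ_k(𝒪_k) = 1`: "`𝒪^×_k ⊆ k` is an ample subset; for any compact ample subset `S ⊆ 𝒪^×_k` on which
`log_k : 𝒪^×_k → k` is injective, we have `μ_k(S) = μ_k(log_k(S))` [cf. [AbsTopIII], Proposition 5.7, (i),
(c)]", so that "the diagram `k ⊇ 𝒪^×_k →^{log_k} log_k(𝒪^×_k) ⊆ k` induces `ℝ_{>0}`-equivariant isomorphisms of
monoids on the respective realified semi-simplifications '`Rss(−)`', all of which are compatible with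
the log-volume maps" (the formulation of the log-link compatibility at `v ∈ 𝕍^non`), and this is
"compatible with passing to finite extensions" (`𝒪_{k₂} ≅ 𝒪_{k₁}^{[k₂:k₁]}` as compact groups). Typed over
abstract data (`U` = units, `logk`, `vol`): measure preservation on compact ample sets where `log_k`
is injective. (TODO-merge: abc-iut-L4-t3, [AbsTopIII] Prop. 5.7 (i)(c).)
[claim: Mochizuki2012, status: disputed] -/
def Remark394iii_logPreservesVolume {k : Type u} [TopologicalSpace k] (U : Set k) (logk : k → k)
    (vol : Set k → ℝ≥0∞) : Prop :=
  ∀ S ⊆ U, IsCompact S → 0 < vol S → Set.InjOn logk S → vol (logk '' S) = vol S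

/-- **IUTchIII:Rmk3.9.4(iv)** (kurims p.124 l.1–30) At `v ∈ 𝕍^bad`, `q := q_v`: the operations
`k ⇝ 𝒪^×_k × q^ℕ (⊆ k) ⇝ 𝒪^×_k (⊆ k) ⇝ log_k(𝒪^×_k) (⊆ k) ⇝ k` "induce `ℝ_{>0}`-equivariant isomorphisms of monoids
`Rss(k) ≅ Rss(𝒪^×_k) ≅ Rss(log_k(𝒪^×_k)) ≅ Rss(k)` … compatible with the respective [normalized] log-volume maps …
in such a way as to avoid any interference, up to multiplication by roots of unity, with the submonoid
`q^ℕ ⊆ k`, which induces … an embedding `ℕ ↪ Rss(k) ≅ ℝ ∪ {−∞}` that maps `ℕ ∋ 1 ↦ −log(q) ∈ ℝ` [where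
`log(q) := ord_v(q_v) · log(p_v)`]". Typed (the embedding clause): the normalized log-volume of
`q^n · 𝒪_k` is `−n · log(q)` with `log(q) = ord_v(q_v) · log(p_v) > 0`, over an abstract log-volume `lvol`
and multiplication action. [claim: Mochizuki2012, status: disputed] -/
def Remark394iv_qEmbedding {k : Type u} [Monoid k] (q : k) (O : Set k) (lvol : Set k → ℝ) (ordq : ℕ)
    (pv : ℕ) : Prop :=
  ∀ n : ℕ, lvol ((fun x => q ^ n * x) '' O) = -(n * (ordq * Real.log pv))

/-- **IUTchIII:Rmk3.9.4(v)** (kurims p.124 l.31 – p.125 l.35) For `k_{i_A} := ⊗_{α∈A} k_{i_α}` with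
`μ(𝒪_{k_{i_A}}) = 1`: "the natural structure of `k_{i_A}` as a `k_{i_α}`-algebra determines natural
`ℝ_{>0}`-equivariant isomorphisms of monoids `Rss(ℚ_{p_v})^{⊗d_A} ≅ Rss(k_{i_α})^{⊗d_α} ≅ Rss(k_{i_A})` — where
`d_α := Π_{β∈A∖{α}} [k_{i_β} : ℚ_{p_v}]`, `d_A := d_α · [k_{i_α} : ℚ_{p_v}]`", so that the log-link compatibility
for `Rss(k_{i_A})` is "the `d_A`-th tensor power of the log-link compatibility … [for] `Rss(ℚ_{p_v})`" —
"independent of the choice of `α ∈ A`". Typed (the numerical content): `d_A = d_α · [k_{i_α} : ℚ_{p_v}]` is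
independent of `α`, both being `Π_{β∈A} [k_{i_β} : ℚ_{p_v}]` — PROVED. [claim: Mochizuki2012, status: disputed] -/
theorem Remark394v_dA_indep {A : Type u} [Fintype A] [DecidableEq A] (deg : A → ℕ) (α : A) :
    (∏ β ∈ Finset.univ.erase α, deg β) * deg α = ∏ β, deg β :=
  Finset.prod_erase_mul _ _ (Finset.mem_univ α)

/-- **IUTchIII:Rmk3.9.4(vi)** (kurims p.125 l.36 – p.126 l.40) Archimedean `k` (≅ ℂ) with the standard
metric, `𝒪^×_k` of length `2π`, `|k| := k/𝒪^×_k`: via (a) closed arcs of measure `< ε`, (b) their additive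
translates to `0`, (c) projection to `|k|`, (d) `ε → 0`, "we obtain … a natural `ℝ_{>0}`-equivariant
isomorphism of monoids `ρ_k : Rss(𝒪^×_k) ≅ Rss(|k|)`" and the diagram
`|k| ↞ k ⊇ 𝒪^×_k ←^{exp_k} log_k(𝒪^×_k) ⊆ k ↠ |k|` "induces `ℝ_{>0}`-equivariant isomorphisms of monoids on the
respective realified semi-simplifications …, each … compatible with the [radial/angular] log-volume
map of [AbsTopIII], Proposition 5.7, (ii), (a)" — the log-link compatibility at `v ∈ 𝕍^arc`. Typed over
abstract data: volume preservation of `exp_k` on ample subsets of `log_k(𝒪^×_k)` mapping bijectively onto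
their image ([AbsTopIII] Prop. 5.7 (ii)(c); TODO-merge: abc-iut-L4-t2/t3).
[claim: Mochizuki2012, status: disputed] -/
def Remark394vi_expPreservesVolume {k : Type u} (L : Set k) (expk : k → k) (volAng : Set k → ℝ≥0∞)
    (volLin : Set k → ℝ≥0∞) : Prop :=
  ∀ S ⊆ L, Set.InjOn expk S → volAng (expk '' S) = volLin S

/-- **IUTchIII:Rmk3.9.4(vi)** (kurims p.125 l.36 – p.126 l.40) — CORRECTED typing with the compactness
hypothesis the text works under ("ample" = relatively compact Borel of positive measure, p.120 l.23–25;
"by considering ample `S ⊆ log_k(𝒪^×_k)` that map bijectively to `exp_k(S) ⊆ 𝒪^×_k`", p.126): finding of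
abc-iut-L6-d4 (INBOX 2026-08-25T19:53:28Z) — the hypothesis-free `Remark394vi_expPreservesVolume` above is
classically FALSE for non-measurable `S` (Bernstein-type set on the circle) and is a recorded
mis-typing. This primed form is PROVED for `k = ℂ` by abc-iut-L6-d4's companion
(`Remark394vi_expPreservesVolume_of_isCompact`, p406145). [claim: Mochizuki2012, status: disputed] -/
def Remark394vi_expPreservesVolume' {k : Type u} [TopologicalSpace k] (L : Set k) (expk : k → k)
    (volAng : Set k → ℝ≥0∞) (volLin : Set k → ℝ≥0∞) : Prop :=
  ∀ S ⊆ L, IsCompact S → Set.InjOn expk S → volAng (expk '' S) = volLin S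

/-- The hypothesis-free form implies the corrected (compact) form — PROVED (so any instance of the former
that does hold yields the latter). [claim: Mochizuki2012, status: disputed] -/
theorem Remark394vi_expPreservesVolume'_of {k : Type u} [TopologicalSpace k] {L : Set k} {expk : k → k}
    {volAng volLin : Set k → ℝ≥0∞} (h : Remark394vi_expPreservesVolume L expk volAng volLin) :
    Remark394vi_expPreservesVolume' L expk volAng volLin :=
  fun S hS _ hinj => h S hS hinj

end LogCompat

end Literature.IUT.LogThetaLattice
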